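import Summits.FinalStateConjecture.FinalStateConjecture.Theorems.WeightedQuasiStationarity.Negative.KinematicShadowBoost
import Summits.FinalStateConjecture.FinalStateConjecture.Theorems.WeightedQuasiStationarity.Negative.KinematicShadowCalculus
import Mathlib.Analysis.SpecialFunctions.Pow.Real
import Mathlib.Analysis.SpecialFunctions.Trigonometric.Basic

/-!
# Route EIHFluxBalance — item `WeightedQuasiStationarity` (stmt-FinalStateConjecture-16928),
# negative lane: weighted Faà di Bruno bound and the sampling times of the second witness

Helper file of the strengthened kinematic-shadow refutation
`…WeightedQuasiStationarity.Negative.KinematicShadowJetRates` (`--supports stmt-FinalStateConjecture-16928`;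
no Theses decl is asserted).

* `exists_norm_iteratedDeriv_comp_le` — the pointwise form of `tendsto_iteratedDeriv_comp`: one
  constant `C` (derivatives of `F` of order `≤ 3` on the compact ball `‖u‖ ≤ r`) such that
  `‖(F ∘ w)⁽ᵐ⁾(t)‖ ≤ m!·C·Dᵐ` whenever `‖w⁽ⁱ⁾(t)‖ ≤ Dⁱ` (`1 ≤ i ≤ m ≤ 3`);
* `rpow_three_quarters_le` — `t^{3/4} ≤ (1+t²)^{3/8}` (`t ≥ 0`);
* `weighted_ampl2_ge` — the weighted first-order rate of the second witness at its sampling times is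
  bounded below: `1/4 ≤ t^{3/4} · (1+t²)^{-1/8} · (2t(1/4)(1+t²)^{1/4-1})` for `t ≥ 1`;
* `samplingTime_spec` — the times `tₙ = √((2πn)⁴ − 1)`, `n ≥ 1`: `1 + tₙ² = (2πn)⁴`,
  `((2πn)⁴)^{1/4} = 2πn` (so `sin ψ(tₙ) = 0`, `cos ψ(tₙ) = 1` for `ψ = (1+t²)^{1/4}`), and `n ≤ tₙ`.
-/

set_option linter.dupNamespace false

noncomputable section

namespace Summit.FinalStateConjecture.FinalStateConjecture.Theorems.WeightedQuasiStationarity.Negative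

open scoped Topology
open Filter Set Function Metric Literature.Geometry.Lorentzian

/-! ### Pointwise Faà di Bruno bound with a uniform constant -/

/-- **Pointwise Faà di Bruno bound, uniform constant.** For `F : E3 → E4` smooth on the open unit
ball and a smooth path `w` with `‖w(t)‖ ≤ r < 1` there is `C ≥ 0` such that for every `t`, every
`D ≥ 0` and every `m ≤ 3`: if `‖w⁽ⁱ⁾(t)‖ ≤ Dⁱ` for `1 ≤ i ≤ m` then `‖(F ∘ w)⁽ᵐ⁾(t)‖ ≤ m!·C·Dᵐ`
(`norm_iteratedFDeriv_comp_le'`, with `C` a bound of the derivatives of `F` of order `≤ 3` on the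
compact ball `‖u‖ ≤ r`). [folklore] -/
theorem exists_norm_iteratedDeriv_comp_le {F : E3 → E4} {w : ℝ → E3} {r : ℝ} (hr : r < 1)
    (hF : ContDiffOn ℝ (⊤ : ℕ∞) F (ball 0 1)) (hw : ContDiff ℝ (⊤ : ℕ∞) w) (hwr : ∀ t, ‖w t‖ ≤ r) :
    ∃ C : ℝ, 0 ≤ C ∧ ∀ (t D : ℝ) (m : ℕ), m ≤ 3 →
      (∀ i, 1 ≤ i → i ≤ m → ‖iteratedDeriv i w t‖ ≤ D ^ i) →
      ‖iteratedDeriv m (fun s ↦ F (w s)) t‖ ≤ m.factorial * C * D ^ m := by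
  have hOo : IsOpen (ball (0 : E3) 1) := isOpen_ball
  have hKc : IsCompact (closedBall (0 : E3) r) := isCompact_closedBall _ _
  have hKO : closedBall (0 : E3) r ⊆ ball 0 1 := closedBall_subset_ball hr
  have hbound : ∀ i : ℕ, ∃ C : ℝ, ∀ u ∈ closedBall (0 : E3) r,
      ‖iteratedFDerivWithin ℝ i F (ball 0 1) u‖ ≤ C := by
    intro i
    have h1 := hF.continuousOn_iteratedFDerivWithin (m := i) (by exact_mod_cast le_top)
      hOo.uniqueDiffOn
    obtain ⟨C, hC⟩ := hKc.exists_bound_of_continuousOn (h1.mono hKO)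
    exact ⟨C, hC⟩
  choose C hC using hbound
  set Cmax : ℝ := ∑ i ∈ Finset.range 4, |C i| with hCmax
  have hCmax0 : 0 ≤ Cmax := Finset.sum_nonneg fun _ _ ↦ abs_nonneg _
  have hCi : ∀ i ≤ 3, ∀ u ∈ closedBall (0 : E3) r, ‖iteratedFDerivWithin ℝ i F (ball 0 1) u‖ ≤ Cmax :=
    fun i hi u hu ↦ ((hC i u hu).trans (le_abs_self _)).trans
      (Finset.single_le_sum (f := fun i ↦ |C i|) (fun _ _ ↦ abs_nonneg _)
        (Finset.mem_range.mpr (by omega)))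
  have hwt : ∀ t, w t ∈ closedBall (0 : E3) r := fun t ↦ by simpa using hwr t
  have hrange : Set.range w ⊆ ball 0 1 := by
    rintro _ ⟨t, rfl⟩
    exact hKO (hwt t)
  refine ⟨Cmax, hCmax0, fun t D m hm hD ↦ ?_⟩
  have hD' : ∀ i, 1 ≤ i → i ≤ m → ‖iteratedFDeriv ℝ i w t‖ ≤ D ^ i := fun i hi1 him ↦ by
    rw [norm_iteratedFDeriv_eq_norm_iteratedDeriv]; exact hD i hi1 him
  have hCt : ∀ i ≤ m, ‖iteratedFDerivWithin ℝ i F (ball 0 1) (w t)‖ ≤ Cmax :=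
    fun i hi ↦ hCi i (hi.trans hm) (w t) (hwt t)
  have hcomp := norm_iteratedFDeriv_comp_le' (𝕜 := ℝ) (g := F) (f := w) (n := m)
    (N := ((⊤ : ℕ∞) : WithTop ℕ∞)) hrange hOo.uniqueDiffOn hF hw (by exact_mod_cast le_top) t hCt hD'
  rw [← norm_iteratedFDeriv_eq_norm_iteratedDeriv]
  exact hcomp

/-! ### Weights against powers of `1 + t²` -/

/-- `t^{3/4} ≤ (1+t²)^{3/8}` for `t ≥ 0` (`t ≤ (1+t²)^{1/2}`). [folklore] -/
theorem rpow_three_quarters_le {t : ℝ} (ht : 0 ≤ t) :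
    t ^ (3 / 4 : ℝ) ≤ (1 + t ^ 2) ^ (3 / 8 : ℝ) := by
  have hf : (0 : ℝ) ≤ 1 + t ^ 2 := by positivity
  have h1 : t ≤ (1 + t ^ 2) ^ (1 / 2 : ℝ) := by
    rw [← Real.sqrt_eq_rpow]
    have := Real.abs_le_sqrt (show t ^ 2 ≤ 1 + t ^ 2 by linarith)
    rwa [abs_of_nonneg ht] at this
  calc t ^ (3 / 4 : ℝ) ≤ ((1 + t ^ 2) ^ (1 / 2 : ℝ)) ^ (3 / 4 : ℝ) :=
        Real.rpow_le_rpow ht h1 (by norm_num)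
    _ = (1 + t ^ 2) ^ (3 / 8 : ℝ) := by
        rw [← Real.rpow_mul hf]
        norm_num

/-- **Lower bound of the weighted first-order rate of the second witness at its sampling times**:
`1/4 ≤ t^{3/4}·((1+t²)^{-1/8}·(2t·(1/4)·(1+t²)^{1/4-1}))` for `t ≥ 1` (the bracket is `A ψ'`, the
value of `u̇/ε` where `sin ψ = 0`, `cos ψ = 1`; `(t^{7/4}(1+t²)^{-7/8})⁸ = t¹⁴/(1+t²)⁷ ≥ 2⁻⁷`).
[folklore] -/
theorem weighted_ampl2_ge {t : ℝ} (ht : 1 ≤ t) :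
    1 / 4 ≤ t ^ (3 / 4 : ℝ) * ((1 + t ^ 2) ^ (-(1 / 8) : ℝ) *
      (2 * t * (1 / 4 : ℝ) * (1 + t ^ 2) ^ ((1 / 4 : ℝ) - 1))) := by
  have ht0 : 0 < t := one_pos.trans_le ht
  have hf : (0 : ℝ) < 1 + t ^ 2 := by positivity
  -- rewrite as `(1/2) x` with `x = t^{7/4} (1+t²)^{-7/8}`
  set x : ℝ := t ^ (7 / 4 : ℝ) * (1 + t ^ 2) ^ (-(7 / 8) : ℝ) with hx
  have hx0 : 0 ≤ x := mul_nonneg (Real.rpow_nonneg ht0.le _) (Real.rpow_nonneg hf.le _)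
  have hrew : t ^ (3 / 4 : ℝ) * ((1 + t ^ 2) ^ (-(1 / 8) : ℝ) *
      (2 * t * (1 / 4 : ℝ) * (1 + t ^ 2) ^ ((1 / 4 : ℝ) - 1))) = (1 / 2) * x := by
    have h1 : t ^ (7 / 4 : ℝ) = t ^ (3 / 4 : ℝ) * t := by
      rw [show (7 / 4 : ℝ) = 3 / 4 + 1 by norm_num, Real.rpow_add_one ht0.ne']
    have h2 : (1 + t ^ 2) ^ (-(7 / 8) : ℝ) =
        (1 + t ^ 2) ^ (-(1 / 8) : ℝ) * (1 + t ^ 2) ^ ((1 / 4 : ℝ) - 1) := by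
      rw [← Real.rpow_add hf]; norm_num
    rw [hx, h1, h2]; ring
  rw [hrew]
  -- `x⁸ = t¹⁴ (1+t²)⁻⁷ ≥ 2⁻⁸`
  have hx8 : x ^ 8 = t ^ 14 * ((1 + t ^ 2) ^ 7)⁻¹ := by
    rw [hx, mul_pow, ← Real.rpow_natCast (t ^ (7 / 4 : ℝ)) 8, ← Real.rpow_mul ht0.le,
      ← Real.rpow_natCast ((1 + t ^ 2) ^ (-(7 / 8) : ℝ)) 8, ← Real.rpow_mul hf.le]
    norm_num
    left
    norm_cast
  have hf2 : 1 + t ^ 2 ≤ 2 * t ^ 2 := by nlinarith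
  have hx8ge : (1 / 2 : ℝ) ^ 8 ≤ x ^ 8 := by
    rw [hx8, show t ^ 14 * ((1 + t ^ 2) ^ 7)⁻¹ = t ^ 14 / (1 + t ^ 2) ^ 7 from rfl,
      le_div_iff₀ (by positivity)]
    have h7 : (1 + t ^ 2) ^ 7 ≤ (2 * t ^ 2) ^ 7 := pow_le_pow_left₀ hf.le hf2 7
    nlinarith [pow_nonneg ht0.le 14]
  have hxge : 1 / 2 ≤ x := le_of_pow_le_pow_left₀ (by norm_num) hx0 hx8ge
  linarith

/-! ### The sampling times `tₙ = √((2πn)⁴ − 1)` -/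

/-- **Sampling times of the second witness.** For `n ≥ 1` and `tₙ = √((2πn)⁴ − 1)`:
`1 + tₙ² = (2πn)⁴`, `((2πn)⁴)^{1/4} = 2πn`, `sin (2πn) = 0`, `cos (2πn) = 1`, and `n ≤ tₙ`. [folklore] -/
theorem samplingTime_spec {n : ℕ} (hn : 1 ≤ n) :
    1 + Real.sqrt ((n * (2 * Real.pi)) ^ 4 - 1) ^ 2 = (n * (2 * Real.pi)) ^ 4 ∧
    ((n * (2 * Real.pi)) ^ 4) ^ (1 / 4 : ℝ) = n * (2 * Real.pi) ∧
    Real.sin (n * (2 * Real.pi)) = 0 ∧ Real.cos (n * (2 * Real.pi)) = 1 ∧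
    (n : ℝ) ≤ Real.sqrt ((n * (2 * Real.pi)) ^ 4 - 1) := by
  have hπ : (3 : ℝ) < Real.pi := Real.pi_gt_three
  have hn1 : (1 : ℝ) ≤ n := by exact_mod_cast hn
  have hb : (6 : ℝ) ≤ n * (2 * Real.pi) := by nlinarith
  have hb0 : (0 : ℝ) ≤ n * (2 * Real.pi) := by linarith
  have hb4 : (1 : ℝ) ≤ (n * (2 * Real.pi)) ^ 4 - 1 := by
    have : (6 : ℝ) ^ 4 ≤ (n * (2 * Real.pi)) ^ 4 := pow_le_pow_left₀ (by norm_num) hb 4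
    nlinarith
  refine ⟨?_, ?_, ?_, Real.cos_nat_mul_two_pi n, ?_⟩
  · rw [Real.sq_sqrt (by linarith)]; ring
  · rw [show (1 / 4 : ℝ) = ((4 : ℕ) : ℝ)⁻¹ by norm_num]
    exact Real.pow_rpow_inv_natCast hb0 (by norm_num)
  · have h := Real.sin_nat_mul_pi (2 * n)
    push_cast at h
    rw [← h]; ring_nf
  · refine Real.le_sqrt_of_sq_le ?_
    -- `n² ≤ (2πn)⁴ − 1`
    have h1 : (n : ℝ) ^ 2 ≤ (n : ℝ) ^ 4 := by nlinarith [pow_le_pow_left₀ zero_le_one hn1 2]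
    have h2 : (6 : ℝ) ^ 4 * (n : ℝ) ^ 4 ≤ (n * (2 * Real.pi)) ^ 4 := by
      rw [mul_pow]
      have : (6 : ℝ) ^ 4 ≤ (2 * Real.pi) ^ 4 := pow_le_pow_left₀ (by norm_num) (by linarith) 4
      nlinarith [pow_nonneg (Nat.cast_nonneg n : (0 : ℝ) ≤ n) 4]
    nlinarith [pow_nonneg (Nat.cast_nonneg n : (0 : ℝ) ≤ n) 4]

end Summit.FinalStateConjecture.FinalStateConjecture.Theorems.WeightedQuasiStationarity.Negative

end
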